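import Literature.NumberTheory.Rogawski1990.ArchCentralLimitWallLimitValue          -- FILE A (this seat): the wall twin, the chart reduction, the diagonal step, at the orbital integral
import Literature.NumberTheory.Rogawski1990.ArchCentralLimitCornerValueFromBall      -- ★ p844274 (o4): `kMass_mul_orbital_eq_orbital_kAverage`, `hasCompactSupport_comp_conjFrame`, `kAverage_comp_conjFrame_circleDiagonal_const`, frame ★ A-p18
import Literature.NumberTheory.Rogawski1990.ArchCentralLimitBallExportAdapter        -- ★ p844486 (o4′): `ballWallValue_of_core` (W6's `hcore` ⟹ `hBall`)
import Literature.NumberTheory.Rogawski1990.ArchCentralLimitFormulaOfOppositeSigns   -- ★ p844336 (G′): `archCentralLimitFormulaRankTwo_of_ppm` (all frames from the CM pattern `(+,+,−)`)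
import HarnessLib

/-!
# THE (L_{U(2,1)}) LETTER FROM THE CONTINUITY HALF OF ROGAWSKI'S SENTENCE (A6′) AND THE IN-HOUSE VALUE (W6-core) — no corner extension, no jump relation
# (Rogawski 1990 §8.4 p. 126 L13 «`ω[ρ(γ)′Δ(γ)Φ_G(γ,f)]` is continuous at `γ₀` and its value there is equal to `c_G f(γ₀)`»; Harish-Chandra 1975 [H₂] L. 17.5 — FILE B of «A6′»)

Topic `NumberTheory/Rogawski1990`; namespace `Literature.NumberTheory.Rogawski1990`.  THEOREMS ONLY (no `def`, no instance, no notation, no axiom, no named fact, no `sorry`).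
Cell `pub/hodgecm-mathlib`, ENGINE T1 (crux H413 = `stmt-HodgeConjecture-24833`), supports-only lane; pay-down mirror «SdArch» `Cruxes/H413/Lines/F0_P3a_SdArch.lean` ED. 5 (one open stub
`stub_A6 : ∀ L α w, ArchCentralLimitCornerRegularity L α w`, PRINTED [HC 1975 §17 L. 17.5], books #179).  Author F0P3a-p09 (g2), 2026-09-01 (offer «A6′ — the literal half-sentence row», P3a bus
18:35Z; LEAD F0P3a-plan (g12) T11-1: «=» as candidate re-denomination of #179, count-neutral; SdArch ED. 6 «A6 ↦ A6′» ∕ closer ED. 35 «L21 ⟸ A6′» are the LEAD's∕owner's calls, not this file's).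

WHAT IS PROVED (over ★ files and FILE A; the only print input is the HYPOTHESIS (A6′), written UNFOLDED in the letter's verbatim tokens — the def `ArchCentralLimitExists` is the
companion def-lane file `ArchCentralLimitExistsLetter`):
**`archCentralLimitFormulaRankTwo_of_limitExists_of_core (hex : ∀ L α w, ‹ArchCentralLimitExists L α w, unfolded›) (hcore : ‹stub_W6core›) : ∀ L α w, ArchCentralLimitFormulaRankTwo L α w`** —
the N1 letter ★ `ArchCentralLimitFormulaRankTwo` (p842205) from (i) the EXISTENCE of `V = lim_{T_reg ∋ z → ζ•1} Λ₈[F_Θ](z)` (Rogawski's «continuous at `γ₀`») and (ii) W6-core's ball-model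
wall identity `hcore` (= ★ `stub_W6core` of «SdArch» ED. 5, text VERBATIM, sorry-free since p845507∕p846302).  ED. 4 of the mirror derived the letter from (A6) corner extensions on SIX
chambers + `hcore` + the S-chamber third-jet jump ★ `wall02_cubeLimit`; here NEITHER the corner extensions NOR the jump relation is used:
* §5 **`centralLimit_eq_of_ball_of_tendsto`** — the frame transport `U(2,1) → G_w` at a `(+,+,−)` frame, VERBATIM the ★ (o4) transport `cornerValue_min_of_ball` (diagonal frame
  ★ `exists_continuousMulEquiv_archLocal_U21_torus`, `Θ′ := (Θ∘Ad T)^K` ★ `K`-average, ★ `kMass_mul_orbital_eq_orbital_kAverage` off the noncompact walls, so `m_K⁻¹ψ, m_K⁻¹χ` are wall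
  germs for `Φ^{G_w}_Θ`), with the corner-extension step REPLACED by FILE A: the letter's filter ⟶ the `θ₂`-minimal chamber `{θ₂ < θ₁ < θ₀}` in the chart ⟶ the wall (diagonal step) ⟶
  the value (wall twin).  Net: ONE `c(ν) > 0` with `V = −(c·i)·Θ(ζ•1)` for every `Θ, ζ` and EVERY limit `V` of `Λ₈[F_Θ]` along `𝓝[{z | z injective}] (ζ,ζ,ζ)`;
* §6 the letter at `(+,+,−)` frames (`ArchCentralLimitFormulaRankTwo.of_limitExists_of_ball`, `…of_core` via ★ `ballWallValue_of_core`) and at ALL frames (★ `archCentralLimitFormulaRankTwo_of_ppm`).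
USE (LEAD T11-1): `stub_ArchCentralLimitU21 := archCentralLimitFormulaRankTwo_of_limitExists_of_core stub_A6' stub_W6core` with `stub_A6' : ∀ L α w, ArchCentralLimitExists L α w` (PRINTED,
Rogawski p. 126 L13 first half = [H₂] L. 17.5) replacing `stub_A6`.
HONEST LABEL: HC_CM is proved only modulo the printed citations until rung 0 closes; this file re-derives the printed-hard letter N1 from a WEAKER printed input and pays no row by itself.

## References
* [Rogawski1990] J. D. Rogawski, *Automorphic Representations of Unitary Groups in Three Variables*, Ann. of Math. Stud. 123 (1990), §8.4 pp. 126–127, Prop. 8.4.1(b) (held scan p0126–p0127 read).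
* [HarishChandra1975HARRG1] Harish-Chandra, *Harmonic analysis on real reductive groups. I*, J. Funct. Anal. 19 (1975) 104–204, §17 Lemma 17.5 (not held; cited through Rogawski).
* [Varadarajan1989] V. S. Varadarajan, *An Introduction to Harmonic Analysis on Semisimple Lie Groups* (1989), §6.4.
-/

set_option autoImplicit false

noncomputable section

open Filter Topology Set Function Complex MeasureTheory Measure NumberField NumberField.InfinitePlace Matrix MulAction
open scoped ContDiff Matrix MatrixGroups Matrix.Norms.Operator
open Literature.Analysis.Calculus Literature.Topology
open Literature.NumberTheory.Automorphic Literature.NumberTheory.Automorphic.UnitaryGroup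
open Literature.Geometry.ComplexHyperbolic Literature.Geometry.ComplexHyperbolic.BallModel

namespace Literature.NumberTheory.Rogawski1990

/-! ## §3′ Chart reduction of a limit along the letter's filter `𝓝[{z | z injective}] (ζ,ζ,ζ)` (generic torus function) -/

section Chart

variable {β : Type*}

/-- The angle chart `θ ↦ (ζe^{iθ_k})_k` is continuous. [cite: Rogawski1990, §8.4 p. 126] -/
theorem continuous_angleChart (ζ : Circle) : Continuous fun θ : Fin 3 → ℝ => fun k : Fin 3 => ζ * Circle.exp (θ k) :=
  continuous_pi fun k => continuous_const.mul (Circle.exp.continuous.comp (continuous_apply k))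

/-- The angle chart at `θ = 0` is the centre `(ζ,ζ,ζ)`. [cite: Rogawski1990, §8.4 p. 126] -/
theorem angleChart_zero (ζ : Circle) : (fun k : Fin 3 => ζ * Circle.exp ((0 : Fin 3 → ℝ) k)) = fun _ : Fin 3 => ζ := by
  funext k
  simp only [Pi.zero_apply, Circle.exp_zero, mul_one]

/-- **The chart maps a chamber at the corner into the letter's filter**: `θ ↦ (ζe^{iθ_k})_k` tends, along `𝓝[C_σ] 0`, to `(ζ,ζ,ζ)` WITHIN the regular torus points (strictly ordered
small angles are pairwise distinct mod `2π`, ★ `injective_angleChart_of_injective`). [cite: Rogawski1990, §8.4 p. 126] -/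
theorem tendsto_angleChart_nhdsWithin_chamber_nhdsWithin_injective (ζ : Circle) (σ : Equiv.Perm (Fin 3)) :
    Tendsto (fun θ : Fin 3 → ℝ => fun k : Fin 3 => ζ * Circle.exp (θ k)) (𝓝[{θ : Fin 3 → ℝ | θ (σ 0) < θ (σ 1) ∧ θ (σ 1) < θ (σ 2)}] 0)
      (𝓝[{z : Fin 3 → Circle | Function.Injective z}] (fun _ : Fin 3 => ζ)) := by
  refine tendsto_nhdsWithin_iff.2 ⟨?_, ?_⟩
  · have h := ((continuous_angleChart ζ).tendsto (0 : Fin 3 → ℝ)).mono_left (nhdsWithin_le_nhds (s := {θ : Fin 3 → ℝ | θ (σ 0) < θ (σ 1) ∧ θ (σ 1) < θ (σ 2)}))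
    rwa [angleChart_zero] at h
  · have hsmall : ∀ᶠ θ : Fin 3 → ℝ in 𝓝[{θ : Fin 3 → ℝ | θ (σ 0) < θ (σ 1) ∧ θ (σ 1) < θ (σ 2)}] 0, ‖θ‖ < 1 / 2 :=
      mem_nhdsWithin_of_mem_nhds (by simpa only [Metric.ball, dist_zero_right] using Metric.ball_mem_nhds (0 : Fin 3 → ℝ) (by norm_num : (0 : ℝ) < 1 / 2))
    filter_upwards [self_mem_nhdsWithin, hsmall] with θ hθ hθs
    have hinj : Function.Injective θ := by
      have hmem : θ ∈ {θ : Fin 3 → ℝ | Function.Injective θ} := by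
        rw [setOf_injective_eq_iUnion_chamber]
        exact mem_iUnion.2 ⟨σ, hθ⟩
      exact hmem
    refine injective_angleChart_of_injective hinj fun i j => ?_
    have hi : |θ i| ≤ ‖θ‖ := by rw [← Real.norm_eq_abs]; exact norm_le_pi_norm θ i
    have hj : |θ j| ≤ ‖θ‖ := by rw [← Real.norm_eq_abs]; exact norm_le_pi_norm θ j
    calc |θ i - θ j| ≤ |θ i| + |θ j| := abs_sub _ _
      _ < 1 := by linarith

/-- **CHART REDUCTION OF THE LETTER'S FILTER (the converse direction of ★ `tendsto_nhdsWithin_injective_of_tendsto_angleChart`).**  For ANY `F : (S¹)³ → β`: if `F → ℓ` along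
`𝓝[{z | z injective}] (ζ,ζ,ζ)`, then `θ ↦ F(ζe^{iθ})` tends to `ℓ` as `θ → 0` within every chamber `C_σ`. [cite: Rogawski1990, §8.4 p. 126] -/
theorem tendsto_angleChart_nhdsWithin_chamber_of_tendsto_nhdsWithin_injective (F : (Fin 3 → Circle) → β) (ζ : Circle) (l : Filter β)
    (h : Tendsto F (𝓝[{z : Fin 3 → Circle | Function.Injective z}] (fun _ : Fin 3 => ζ)) l) (σ : Equiv.Perm (Fin 3)) :
    Tendsto (fun θ : Fin 3 → ℝ => F (fun k : Fin 3 => ζ * Circle.exp (θ k))) (𝓝[{θ : Fin 3 → ℝ | θ (σ 0) < θ (σ 1) ∧ θ (σ 1) < θ (σ 2)}] 0) l :=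
  h.comp (tendsto_angleChart_nhdsWithin_chamber_nhdsWithin_injective ζ σ)

/-- **The letter's 8-ray functional read in the angle chart IS the 8-ray LINE functional of `Fz∘chart_ζ`** (the rays `s ↦ ζe^{iθ}·e^{isv}` are the chart of the lines `s ↦ θ + s·v`,
★ `angleChart_mul_exp_ray`). [cite: Rogawski1990, §8.4 p. 126] -/
theorem lambda8_angleChart_eq_lambda8Line (Fz : (Fin 3 → Circle) → ℂ) (ζ : Circle) (θ : Fin 3 → ℝ) :
    (1 / 48 : ℂ) * ∑ ε : Fin 3 → Bool, ((((if ε 0 then (1 : ℝ) else -1) * (if ε 1 then (1 : ℝ) else -1) * (if ε 2 then (1 : ℝ) else -1) : ℝ)) : ℂ) *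
        iteratedDeriv 3 (fun s : ℝ => Fz (fun k => ζ * Circle.exp (θ k) * Circle.exp (s * (![(if ε 0 then (1 : ℝ) else -1) + (if ε 1 then (1 : ℝ) else -1), -(if ε 0 then (1 : ℝ) else -1) + (if ε 2 then (1 : ℝ) else -1), -(if ε 1 then (1 : ℝ) else -1) - (if ε 2 then (1 : ℝ) else -1)] k)))) 0 =
      (1 / 48 : ℂ) * ∑ ε : Fin 3 → Bool, ((((if ε 0 then (1 : ℝ) else -1) * (if ε 1 then (1 : ℝ) else -1) * (if ε 2 then (1 : ℝ) else -1) : ℝ)) : ℂ) *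
        iteratedDeriv 3 (fun s : ℝ => (fun θ' : Fin 3 → ℝ => Fz (fun k => ζ * Circle.exp (θ' k)))
          (θ + s • (![(if ε 0 then (1 : ℝ) else -1) + (if ε 1 then (1 : ℝ) else -1), -(if ε 0 then (1 : ℝ) else -1) + (if ε 2 then (1 : ℝ) else -1), -(if ε 1 then (1 : ℝ) else -1) - (if ε 2 then (1 : ℝ) else -1)] : Fin 3 → ℝ))) 0 := by
  refine congrArg (fun t : ℂ => (1 / 48 : ℂ) * t) (Finset.sum_congr rfl fun ε _ => ?_)
  refine congrArg (fun t : ℂ => ((((if ε 0 then (1 : ℝ) else -1) * (if ε 1 then (1 : ℝ) else -1) * (if ε 2 then (1 : ℝ) else -1) : ℝ)) : ℂ) * t) ?_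
  congr 1
  funext s
  congr 1
  funext k
  rw [angleChart_mul_exp_ray ζ _ θ s k, add_comm]

end Chart

/-! ## §5 The frame transport `U(2,1) → G_w` at a `(+,+,−)` frame (VERBATIM the (o4) transport): the limit `V` of the letter's functional is the W6 value -/

section Transfer

variable (L : Type) [Field L] (α : Fin 3 → L) (w : {w : InfinitePlace L // IsComplex w})

/-- On the normal ray through the wall point `ζ·(e^{it}, e^{it}, e^{−2it})`, `0 < t ≤ 2`, the points with `|s| < min (3t∕2) (1∕4)` are off the noncompact walls (★ (o4), private there).
[folklore] -/
private theorem normalRay_off_noncompact_walls' (ζ : Circle) {t s : ℝ} (ht : 0 < t) (ht2 : t ≤ 2) (hs : |s| < min (3 * t / 2) (1 / 4)) :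
    (fun j : Fin 3 => (fun i : Fin 3 => ζ * Circle.exp ((t • (![1, 1, -2] : Fin 3 → ℝ)) i)) j * Circle.exp (s * (![1, -1, 0] : Fin 3 → ℝ) j)) 0 ≠ (fun j : Fin 3 => (fun i : Fin 3 => ζ * Circle.exp ((t • (![1, 1, -2] : Fin 3 → ℝ)) i)) j * Circle.exp (s * (![1, -1, 0] : Fin 3 → ℝ) j)) 2 ∧ (fun j : Fin 3 => (fun i : Fin 3 => ζ * Circle.exp ((t • (![1, 1, -2] : Fin 3 → ℝ)) i)) j * Circle.exp (s * (![1, -1, 0] : Fin 3 → ℝ) j)) 1 ≠ (fun j : Fin 3 => (fun i : Fin 3 => ζ * Circle.exp ((t • (![1, 1, -2] : Fin 3 → ℝ)) i)) j * Circle.exp (s * (![1, -1, 0] : Fin 3 → ℝ) j)) 2 := by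
  have hs1 : |s| < 3 * t / 2 := lt_of_lt_of_le hs (min_le_left _ _)
  have hs2 : |s| < 1 / 4 := lt_of_lt_of_le hs (min_le_right _ _)
  have key : ∀ u : ℝ, |u| < 1 / 4 → |u| < 3 * t / 2 → ζ * Circle.exp t * Circle.exp u ≠ ζ * Circle.exp (-(t * 2)) * Circle.exp 0 := by
    intro u hu hu'
    have hu1 := abs_lt.mp hu
    have hu2 := abs_lt.mp hu'
    rw [Circle.exp_zero, mul_one, mul_assoc, ← Circle.exp_add, Ne, mul_right_inj]
    refine circleExp_ne_of_abs_sub_lt_two_pi (by intro h; linarith) ?_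
    have hπ : (3.14 : ℝ) < Real.pi := by linarith [Real.pi_gt_d2]
    rw [abs_lt]; constructor <;> nlinarith
  simp only [Pi.smul_apply, smul_eq_mul, Matrix.cons_val_zero, Matrix.cons_val_one, Matrix.cons_val_two, Matrix.tail_cons, Matrix.head_cons,
    mul_one, mul_neg, mul_zero]
  refine ⟨key s hs2 hs1, ?_⟩
  have := key (-s) (by rwa [abs_neg]) (by rwa [abs_neg])
  simpa only [mul_neg, mul_one] using this

/-- **THE LIMIT OF THE LETTER'S FUNCTIONAL IS THE BALL-MODEL VALUE** (Rogawski 1990 §8.4, Prop. 8.4.1(b) bookkeeping; Harish-Chandra's descent to `U(2,1)` and averaging over `K = U(2) × U(1)`).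
At a place with `re σ_w(α₀), re σ_w(α₁) > 0 > re σ_w(α₂)`: the ball-model statement `hBall` (★ (o4)'s: for every Haar `μ` on `U(2,1)` one `c(μ) > 0` such that every smooth, compactly supported,
`K`-conjugation-invariant `Θ′` and every `ζ` admit the (A4)-I wall germs `ψ, χ` with `−(2i∕3)ψ″(0⁺) − (i∕2)ψ(0) + (i∕12)χ″(0⁺) = −c·i·Θ′(ζ•1)`) implies: for every Haar right-invariant `ν` on
`G_w` ONE `c > 0` such that for every smooth `Θ` compactly supported on `G_w`, every `ζ`, and EVERY LIMIT `V` of the letter's 8-ray functional `Λ₈[F_Θ]` along `𝓝[{z | z injective}] (ζ,ζ,ζ)`,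
`V = −(c·i)·Θ(ζ•1)`.  Steps: frame `e : G_w ≃ₜ* U(2,1)` (★ A-p18), `Θ′ := (Θ∘Ad T)^K` (★ `K`-average), `m_K·Φ^{G_w}_Θ = Φ^{U(2,1)}_{Θ′}` off the noncompact walls (★ `kMass_mul_orbital_eq_orbital_kAverage`),
so `m_K⁻¹ψ, m_K⁻¹χ` are wall germs for `Φ^{G_w}_Θ`; the letter's filter ⟶ the `θ₂`-minimal chamber `{θ₂ < θ₁ < θ₀}` in the chart (§3) ⟶ the wall (§4) ⟶ the value (§4∕§2).
[cite: Rogawski1990, §8.4 pp. 126–127; Prop. 8.4.1(b)] [cite: Varadarajan1989, §6.4] -/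
theorem centralLimit_eq_of_ball_of_tendsto (h0 : 0 < (w.1.embedding (α 0)).re) (h1 : 0 < (w.1.embedding (α 1)).re) (h2 : (w.1.embedding (α 2)).re < 0)
    (hBall : ∀ (μ : Measure BallModel.U21) [μ.IsHaarMeasure],
      ∃ c : ℝ, 0 < c ∧ ∀ (Θ' : Matrix (Fin 3) (Fin 3) ℂ → ℂ), ContDiff ℝ (⊤ : ℕ∞) Θ' →
        HasCompactSupport (fun u : BallModel.U21 => Θ' (BallModel.mat u)) →
        (∀ κ : Matrix (Fin 3) (Fin 3) ℂ, κ * κᴴ = 1 → κ * BallModel.J = BallModel.J * κ → ∀ X, Θ' (κ * X * κᴴ) = Θ' X) →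
        ∀ ζ : Circle, ∃ (δ : ℝ) (ψ χ : ℝ → ℂ), 0 < δ ∧ δ ≤ 2 ∧ ContDiffOn ℝ 2 ψ (Icc 0 δ) ∧ ContDiffOn ℝ 2 χ (Icc 0 δ) ∧
          (∀ t ∈ Ioo 0 δ, ψ t = ((2 - 2 * Real.cos (3 * t) : ℝ) : ℂ) *
            ∫ u, Θ' (BallModel.mat (u * BallModel.mkU21 (Matrix.diagonal fun i => (((fun j : Fin 3 => ζ * Circle.exp ((t • (![1, 1, -2] : Fin 3 → ℝ)) j)) i : Circle) : ℂ)) (BallModel.diagonal_circle_preserves (fun j : Fin 3 => ζ * Circle.exp ((t • (![1, 1, -2] : Fin 3 → ℝ)) j))) * u⁻¹)) ∂μ) ∧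
          (∀ t ∈ Ioo 0 δ, χ t = ((2 - 2 * Real.cos (3 * t) : ℝ) : ℂ) ^ 2 * iteratedDeriv 2 (fun s : ℝ =>
            ∫ u, Θ' (BallModel.mat (u * BallModel.mkU21 (Matrix.diagonal fun i => (((fun j : Fin 3 => (fun i : Fin 3 => ζ * Circle.exp ((t • (![1, 1, -2] : Fin 3 → ℝ)) i)) j * Circle.exp (s * (![1, -1, 0] : Fin 3 → ℝ) j)) i : Circle) : ℂ)) (BallModel.diagonal_circle_preserves (fun j : Fin 3 => (fun i : Fin 3 => ζ * Circle.exp ((t • (![1, 1, -2] : Fin 3 → ℝ)) i)) j * Circle.exp (s * (![1, -1, 0] : Fin 3 → ℝ) j))) * u⁻¹)) ∂μ) 0) ∧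
          -(2 / 3) * Complex.I * iteratedDerivWithin 2 ψ (Icc 0 δ) 0 - (1 / 2) * Complex.I * ψ 0 + (1 / 12) * Complex.I * iteratedDerivWithin 2 χ (Icc 0 δ) 0 =
            -((c : ℂ) * Complex.I) * Θ' ((circleDiagonal 3 (fun _ => ζ) : GL (Fin 3) ℂ) : Matrix (Fin 3) (Fin 3) ℂ)) :
    ∀ [MeasurableSpace (archLocal L 3 (Matrix.diagonal α) w)] [BorelSpace (archLocal L 3 (Matrix.diagonal α) w)],
      (∀ i, α i ≠ 0) → (∀ i, (w.1.embedding (α i)).im = 0) →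
      ∀ (ν : Measure (archLocal L 3 (Matrix.diagonal α) w)) [ν.IsHaarMeasure] [ν.IsMulRightInvariant],
      ∃ c : ℝ, 0 < c ∧
        ∀ (Θ : Matrix (Fin 3) (Fin 3) ℂ → ℂ), ContDiff ℝ (⊤ : ℕ∞) Θ →
          HasCompactSupport (fun k : archLocal L 3 (Matrix.diagonal α) w => Θ ((k : GL (Fin 3) ℂ) : Matrix (Fin 3) (Fin 3) ℂ)) →
          ∀ (ζ : Circle) (V : ℂ), Tendsto (fun z : Fin 3 → Circle =>
              (1 / 48 : ℂ) * ∑ ε : Fin 3 → Bool, ((((if ε 0 then (1 : ℝ) else -1) * (if ε 1 then (1 : ℝ) else -1) * (if ε 2 then (1 : ℝ) else -1) : ℝ)) : ℂ) *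
                iteratedDeriv 3 (fun s : ℝ => ((((z 0 * Circle.exp (s * (![(if ε 0 then (1 : ℝ) else -1) + (if ε 1 then (1 : ℝ) else -1), -(if ε 0 then (1 : ℝ) else -1) + (if ε 2 then (1 : ℝ) else -1), -(if ε 1 then (1 : ℝ) else -1) - (if ε 2 then (1 : ℝ) else -1)] 0)) : Circle) : ℂ)) * (((z 2 * Circle.exp (s * (![(if ε 0 then (1 : ℝ) else -1) + (if ε 1 then (1 : ℝ) else -1), -(if ε 0 then (1 : ℝ) else -1) + (if ε 2 then (1 : ℝ) else -1), -(if ε 1 then (1 : ℝ) else -1) - (if ε 2 then (1 : ℝ) else -1)] 2)) : Circle) : ℂ))⁻¹) * ((1 - (((z 1 * Circle.exp (s * (![(if ε 0 then (1 : ℝ) else -1) + (if ε 1 then (1 : ℝ) else -1), -(if ε 0 then (1 : ℝ) else -1) + (if ε 2 then (1 : ℝ) else -1), -(if ε 1 then (1 : ℝ) else -1) - (if ε 2 then (1 : ℝ) else -1)] 1)) : Circle) : ℂ)) * (((z 0 * Circle.exp (s * (![(if ε 0 then (1 : ℝ) else -1) + (if ε 1 then (1 : ℝ) else -1), -(if ε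 0 then (1 : ℝ) else -1) + (if ε 2 then (1 : ℝ) else -1), -(if ε 1 then (1 : ℝ) else -1) - (if ε 2 then (1 : ℝ) else -1)] 0)) : Circle) : ℂ))⁻¹) * (1 - (((z 2 * Circle.exp (s * (![(if ε 0 then (1 : ℝ) else -1) + (if ε 1 then (1 : ℝ) else -1), -(if ε 0 then (1 : ℝ) else -1) + (if ε 2 then (1 : ℝ) else -1), -(if ε 1 then (1 : ℝ) else -1) - (if ε 2 then (1 : ℝ) else -1)] 2)) : Circle) : ℂ)) * (((z 1 * Circle.exp (s * (![(if ε 0 then (1 : ℝ) else -1) + (if ε 1 then (1 : ℝ) else -1), -(if ε 0 then (1 : ℝ) else -1) + (if ε 2 then (1 : ℝ) else -1), -(if ε 1 then (1 : ℝ) else -1) - (if ε 2 then (1 : ℝ) else -1)] 1)) : Circle) : ℂ))⁻¹) * (1 - (((z 2 * Circle.exp (s * (![(if ε 0 then (1 : ℝ) else -1) + (if ε 1 then (1 : ℝ) else -1), -(if ε 0 then (1 : ℝ) else -1) + (if ε 2 then (1 : ℝ) else -1), -(if ε 1 then (1 : ℝ) else -1) - (if ε 2 then (1 : ℝ) else -1)]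 2)) : Circle) : ℂ)) * (((z 0 * Circle.exp (s * (![(if ε 0 then (1 : ℝ) else -1) + (if ε 1 then (1 : ℝ) else -1), -(if ε 0 then (1 : ℝ) else -1) + (if ε 2 then (1 : ℝ) else -1), -(if ε 1 then (1 : ℝ) else -1) - (if ε 2 then (1 : ℝ) else -1)] 0)) : Circle) : ℂ))⁻¹)) * (∫ g, Θ (((g * ⟨circleDiagonal 3 (fun k => z k * Circle.exp (s * (![(if ε 0 then (1 : ℝ) else -1) + (if ε 1 then (1 : ℝ) else -1), -(if ε 0 then (1 : ℝ) else -1) + (if ε 2 then (1 : ℝ) else -1), -(if ε 1 then (1 : ℝ) else -1) - (if ε 2 then (1 : ℝ) else -1)] k))), circleDiagonal_mem_archLocal_diagonal L 3 α w _⟩ * g⁻¹ : archLocal L 3 (Matrix.diagonal α) w) : GL (Fin 3) ℂ) : Matrix (Fin 3) (Fin 3) ℂ) ∂ν)) 0)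
            (𝓝[{z : Fin 3 → Circle | Function.Injective z}] (fun _ => ζ)) (𝓝 V) →
            V = -((c : ℂ) * Complex.I) * Θ ((circleDiagonal 3 (fun _ => ζ) : GL (Fin 3) ℂ) : Matrix (Fin 3) (Fin 3) ℂ) := by
  intro _ _ hα hreal ν _ _
  classical
  have hcpt : 0 < (w.1.embedding (α 0)).re * (w.1.embedding (α 1)).re := mul_pos h0 h1
  obtain ⟨T, e, -, he, hez⟩ := exists_continuousMulEquiv_archLocal_U21_torus L α w hreal h0 h1 h2
  haveI : (ν.map e).IsHaarMeasure := isHaarMeasure_map_archLocalEquiv L α w e ν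
  obtain ⟨c, hc, hB⟩ := hBall (ν.map e)
  refine ⟨c, hc, fun Θ hΘ hΘc ζ V hV => ?_⟩
  -- (2)+(3) the transported, `K`-averaged test function `Θ′ = (Θ∘Ad T)^K` (kept opaque behind `hΘ'`)
  obtain ⟨Θ', hΘ'⟩ : ∃ Θ' : Matrix (Fin 3) (Fin 3) ℂ → ℂ, Θ' = fun X => ∫ k : stabilizer U21 x₀,
      Θ ((T : Matrix (Fin 3) (Fin 3) ℂ) * (mat (k : U21) * X * mat ((k⁻¹ : stabilizer U21 x₀) : U21)) * ((T⁻¹ : GL (Fin 3) ℂ) : Matrix (Fin 3) (Fin 3) ℂ)) ∂haar := ⟨_, rfl⟩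
  have hΘTd : ContDiff ℝ ∞ fun M : Matrix (Fin 3) (Fin 3) ℂ => Θ ((T : Matrix (Fin 3) (Fin 3) ℂ) * M * ((T⁻¹ : GL (Fin 3) ℂ) : Matrix (Fin 3) (Fin 3) ℂ)) :=
    contDiff_comp_conjFrame T hΘ
  have hΘTc : HasCompactSupport fun u : U21 => Θ ((T : Matrix (Fin 3) (Fin 3) ℂ) * mat u * ((T⁻¹ : GL (Fin 3) ℂ) : Matrix (Fin 3) (Fin 3) ℂ)) :=
    hasCompactSupport_comp_conjFrame L α w T e he hΘc
  have hΘ'd : ContDiff ℝ (⊤ : ℕ∞) Θ' := by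
    rw [hΘ']
    exact contDiff_kAverage (fun M : Matrix (Fin 3) (Fin 3) ℂ => Θ ((T : Matrix (Fin 3) (Fin 3) ℂ) * M * ((T⁻¹ : GL (Fin 3) ℂ) : Matrix (Fin 3) (Fin 3) ℂ))) hΘTd
  have hΘ'c : HasCompactSupport fun u : U21 => Θ' (mat u) := by
    rw [hΘ']
    exact hasCompactSupport_kAverage_comp_mat (fun M : Matrix (Fin 3) (Fin 3) ℂ => Θ ((T : Matrix (Fin 3) (Fin 3) ℂ) * M * ((T⁻¹ : GL (Fin 3) ℂ) : Matrix (Fin 3) (Fin 3) ℂ))) hΘTc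
  have hΘ'K : ∀ κ : Matrix (Fin 3) (Fin 3) ℂ, κ * κᴴ = 1 → κ * BallModel.J = BallModel.J * κ → ∀ X, Θ' (κ * X * κᴴ) = Θ' X := by
    intro κ hκ hκJ X
    rw [hΘ']
    exact kAverage_conj_of_unitary_comm_J (fun M : Matrix (Fin 3) (Fin 3) ℂ => Θ ((T : Matrix (Fin 3) (Fin 3) ℂ) * M * ((T⁻¹ : GL (Fin 3) ℂ) : Matrix (Fin 3) (Fin 3) ℂ))) hκ hκJ X
  obtain ⟨δ, ψ, χ, hδ, hδ2, hψ, hχ, hψdef, hχdef, hval⟩ := hB Θ' hΘ'd hΘ'c hΘ'K ζ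
  -- the mass `m_K > 0` of `K`, the centre, the orbital identity
  obtain ⟨m, hm⟩ : ∃ m : ℝ, m = (haar : Measure (stabilizer U21 x₀)).real univ := ⟨_, rfl⟩
  have hm0 : 0 < m := by rw [hm]; exact measureReal_univ_pos
  have hmC : (m : ℂ) ≠ 0 := by exact_mod_cast hm0.ne'
  have hcen : Θ' ((circleDiagonal 3 (fun _ => ζ) : GL (Fin 3) ℂ) : Matrix (Fin 3) (Fin 3) ℂ) = (m : ℂ) * Θ ((circleDiagonal 3 (fun _ => ζ) : GL (Fin 3) ℂ) : Matrix (Fin 3) (Fin 3) ℂ) := by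
    rw [hΘ', hm]
    exact kAverage_comp_conjFrame_circleDiagonal_const T Θ ζ
  -- the `G_w` torus orbital integral `Φ` (kept opaque behind `hΦ`)
  obtain ⟨Φ, hΦ⟩ : ∃ Φ : (Fin 3 → Circle) → ℂ, Φ = fun z : Fin 3 → Circle => ∫ g, Θ (((g * ⟨circleDiagonal 3 z, circleDiagonal_mem_archLocal_diagonal L 3 α w z⟩ * g⁻¹ : archLocal L 3 (Matrix.diagonal α) w) : GL (Fin 3) ℂ) : Matrix (Fin 3) (Fin 3) ℂ) ∂ν := ⟨_, rfl⟩
  have horb : ∀ z : Fin 3 → Circle, z 0 ≠ z 2 → z 1 ≠ z 2 →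
      (m : ℂ) * Φ z = ∫ u, Θ' (BallModel.mat (u * BallModel.mkU21 (Matrix.diagonal fun i => (((z) i : Circle) : ℂ)) (BallModel.diagonal_circle_preserves (z)) * u⁻¹)) ∂(ν.map e) := by
    intro z hz02 hz12
    rw [hΦ, hΘ', hm]
    beta_reduce
    exact kMass_mul_orbital_eq_orbital_kAverage L α w hα hreal hcpt T e he hez ν Θ hΘ.continuous hΘc z hz02 hz12
  -- (4) the germs `ψ₁ = m_K⁻¹ψ`, `χ₁ = m_K⁻¹χ` (opaque behind `hψ₁e`, `hχ₁e`) are (A4)-I wall germs for `Φ` on `[0, δ]`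
  obtain ⟨ψ₁, hψ₁e⟩ : ∃ ψ₁ : ℝ → ℂ, ψ₁ = fun t : ℝ => (m : ℂ)⁻¹ * ψ t := ⟨_, rfl⟩
  obtain ⟨χ₁, hχ₁e⟩ : ∃ χ₁ : ℝ → ℂ, χ₁ = fun t : ℝ => (m : ℂ)⁻¹ * χ t := ⟨_, rfl⟩
  have hψ₁ : ContDiffOn ℝ 2 ψ₁ (Icc 0 δ) := hψ₁e ▸ contDiffOn_const.mul hψ
  have hχ₁ : ContDiffOn ℝ 2 χ₁ (Icc 0 δ) := hχ₁e ▸ contDiffOn_const.mul hχ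
  have hψdef₁ : ∀ t ∈ Ioo 0 δ, ψ₁ t = ((2 - 2 * Real.cos (3 * t) : ℝ) : ℂ) * Φ (fun j : Fin 3 => ζ * Circle.exp ((t • (![1, 1, -2] : Fin 3 → ℝ)) j)) := by
    intro t ht
    have hoff := wallPoint_off_noncompact_walls ζ ht.1.ne' (by rw [abs_of_pos ht.1]; exact (ht.2.trans_le hδ2).le)
    rw [hψ₁e]
    beta_reduce
    rw [hψdef t ht, ← horb _ hoff.1 hoff.2, mul_left_comm, inv_mul_cancel_left₀ hmC]
  have hχdef₁ : ∀ t ∈ Ioo 0 δ, χ₁ t = ((2 - 2 * Real.cos (3 * t) : ℝ) : ℂ) ^ 2 *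
      iteratedDeriv 2 (fun s : ℝ => Φ (fun j : Fin 3 => (fun i : Fin 3 => ζ * Circle.exp ((t • (![1, 1, -2] : Fin 3 → ℝ)) i)) j * Circle.exp (s * (![1, -1, 0] : Fin 3 → ℝ) j))) 0 := by
    intro t ht
    have ht2 : t ≤ 2 := (ht.2.trans_le hδ2).le
    -- near `s = 0` the normal ray is off the noncompact walls, so the orbital identity holds there
    have hr : 0 < min (3 * t / 2) (1 / 4) := lt_min (by linarith [ht.1]) (by norm_num)
    have hnear : ∀ᶠ s : ℝ in 𝓝 0, |s| < min (3 * t / 2) (1 / 4) := by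
      filter_upwards [Ioo_mem_nhds (neg_lt_zero.mpr hr) hr] with s hs using abs_lt.mpr hs
    have hEq : (fun s : ℝ => ∫ u, Θ' (BallModel.mat (u * BallModel.mkU21 (Matrix.diagonal fun i => (((fun j : Fin 3 => (fun i : Fin 3 => ζ * Circle.exp ((t • (![1, 1, -2] : Fin 3 → ℝ)) i)) j * Circle.exp (s * (![1, -1, 0] : Fin 3 → ℝ) j)) i : Circle) : ℂ)) (BallModel.diagonal_circle_preserves (fun j : Fin 3 => (fun i : Fin 3 => ζ * Circle.exp ((t • (![1, 1, -2] : Fin 3 → ℝ)) i)) j * Circle.exp (s * (![1, -1, 0] : Fin 3 → ℝ) j))) * u⁻¹)) ∂(ν.map e)) =ᶠ[𝓝 0]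
        (fun s : ℝ => (m : ℂ) * Φ (fun j : Fin 3 => (fun i : Fin 3 => ζ * Circle.exp ((t • (![1, 1, -2] : Fin 3 → ℝ)) i)) j * Circle.exp (s * (![1, -1, 0] : Fin 3 → ℝ) j))) := by
      filter_upwards [hnear] with s hs
      have hoff := normalRay_off_noncompact_walls' ζ ht.1 ht2 hs
      rw [horb _ hoff.1 hoff.2]
    rw [hχ₁e]
    beta_reduce
    rw [hχdef t ht, hEq.iteratedDeriv_eq 2, iteratedDeriv_const_mul_field, mul_left_comm, inv_mul_cancel_left₀ hmC]
  -- §3: the letter's filter ⟶ the `θ₂`-minimal chamber `{θ₂ < θ₁ < θ₀}` (σ = (0 2)) in the chart, in LINE form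
  have hσ : (Equiv.swap (0 : Fin 3) 2) 0 = 2 := Equiv.swap_apply_left _ _
  have hchart := tendsto_angleChart_nhdsWithin_chamber_of_tendsto_nhdsWithin_injective _ ζ _ hV (Equiv.swap (0 : Fin 3) 2)
  have hline : Tendsto (fun x : Fin 3 → ℝ => (1 / 48 : ℂ) * ∑ ε : Fin 3 → Bool, ((((if ε 0 then (1 : ℝ) else -1) * (if ε 1 then (1 : ℝ) else -1) * (if ε 2 then (1 : ℝ) else -1) : ℝ)) : ℂ) *
        iteratedDeriv 3 (fun s : ℝ => (fun θ : Fin 3 → ℝ =>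
          (((ζ * Circle.exp (θ 0) : Circle) : ℂ)) * ((((ζ * Circle.exp (θ 2) : Circle) : ℂ)))⁻¹ *
            ((1 - (((ζ * Circle.exp (θ 1) : Circle) : ℂ)) * ((((ζ * Circle.exp (θ 0) : Circle) : ℂ)))⁻¹) *
              (1 - (((ζ * Circle.exp (θ 2) : Circle) : ℂ)) * ((((ζ * Circle.exp (θ 1) : Circle) : ℂ)))⁻¹) *
              (1 - (((ζ * Circle.exp (θ 2) : Circle) : ℂ)) * ((((ζ * Circle.exp (θ 0) : Circle) : ℂ)))⁻¹)) *
            Φ (fun j => ζ * Circle.exp (θ j)))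
          (x + s • (![(if ε 0 then (1 : ℝ) else -1) + (if ε 1 then (1 : ℝ) else -1), -(if ε 0 then (1 : ℝ) else -1) + (if ε 2 then (1 : ℝ) else -1),
            -(if ε 1 then (1 : ℝ) else -1) - (if ε 2 then (1 : ℝ) else -1)] : Fin 3 → ℝ))) 0)
      (𝓝[{θ : Fin 3 → ℝ | θ ((Equiv.swap (0 : Fin 3) 2) 0) < θ ((Equiv.swap (0 : Fin 3) 2) 1) ∧ θ ((Equiv.swap (0 : Fin 3) 2) 1) < θ ((Equiv.swap (0 : Fin 3) 2) 2)}] 0) (𝓝 V) := by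
    rw [hΦ]
    refine hchart.congr' (Eventually.of_forall fun θ => ?_)
    exact lambda8_angleChart_eq_lambda8Line (fun z' : Fin 3 → Circle => ((z' 0 : ℂ) * ((z' 2 : ℂ))⁻¹ * ((1 - (z' 1 : ℂ) * ((z' 0 : ℂ))⁻¹) * (1 - (z' 2 : ℂ) * ((z' 1 : ℂ))⁻¹) * (1 - (z' 2 : ℂ) * ((z' 0 : ℂ))⁻¹))) *
      ∫ g, Θ (((g * ⟨circleDiagonal 3 z', circleDiagonal_mem_archLocal_diagonal L 3 α w z'⟩ * g⁻¹ : archLocal L 3 (Matrix.diagonal α) w) : GL (Fin 3) ℂ) : Matrix (Fin 3) (Fin 3) ℂ) ∂ν) ζ θ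
  -- §4: the wall limit, then the value
  haveI : IsFiniteMeasureOnCompacts ν := inferInstance
  have hwallLim := tendsto_lambda8Line_wall_orbital L α w hα hreal hcpt ν Θ hΘ hΘc ζ Φ hΦ (Equiv.swap (0 : Fin 3) 2) hσ hline
  obtain ⟨hval₁, -, -⟩ := eq_wallGermValue_of_tendsto_lambda8Line_wall_orbital L α w hα hreal hcpt ν Θ hΘ hΘc ζ Φ hΦ hδ hδ2 hψ₁ hχ₁ hψdef₁ hχdef₁ hwallLim
  rw [hval₁, hψ₁e, hχ₁e, iteratedDerivWithin_const_mul_field, iteratedDerivWithin_const_mul_field]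
  rw [hcen] at hval
  beta_reduce
  calc -(2 / 3) * Complex.I * ((m : ℂ)⁻¹ * iteratedDerivWithin 2 ψ (Icc 0 δ) 0) - (1 / 2) * Complex.I * ((m : ℂ)⁻¹ * ψ 0) +
        (1 / 12) * Complex.I * ((m : ℂ)⁻¹ * iteratedDerivWithin 2 χ (Icc 0 δ) 0)
      = (m : ℂ)⁻¹ * (-(2 / 3) * Complex.I * iteratedDerivWithin 2 ψ (Icc 0 δ) 0 - (1 / 2) * Complex.I * ψ 0 + (1 / 12) * Complex.I * iteratedDerivWithin 2 χ (Icc 0 δ) 0) := by ring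
    _ = (m : ℂ)⁻¹ * (-((c : ℂ) * Complex.I) * ((m : ℂ) * Θ ((circleDiagonal 3 (fun _ => ζ) : GL (Fin 3) ℂ) : Matrix (Fin 3) (Fin 3) ℂ))) := by rw [hval]
    _ = -((c : ℂ) * Complex.I) * Θ ((circleDiagonal 3 (fun _ => ζ) : GL (Fin 3) ℂ) : Matrix (Fin 3) (Fin 3) ℂ) := by
      field_simp

end Transfer

/-! ## §6 THE LETTER from (A6′) and the ball-model value: at the CM frames `(+,+,−)`, and at every frame -/

section Letter

variable (L : Type) [Field L] (α : Fin 3 → L) (w : {w : InfinitePlace L // IsComplex w})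

/-- **The (L_{U(2,1)}) letter at a `(+,+,−)` frame FROM (A6′) AND THE BALL-MODEL VALUE.**  `hex` is ★ `ArchCentralLimitExists L α w` UNFOLDED (the continuity half of Rogawski's p. 126 sentence:
`∃ V, Tendsto Λ₈[F_Θ] (𝓝[T_reg] ζ•1) (𝓝 V)`, in the letter's verbatim tokens); `hBall` is ★ (o4)'s ball-model hypothesis.  Then ★ `ArchCentralLimitFormulaRankTwo L α w`: the constant is §5's, and
for each `Θ, ζ` the limit `V` given by `hex` IS `−(c·i)·Θ(ζ•1)` (§5), so the letter's `Tendsto` is `hex`'s. [cite: Rogawski1990, §8.4 pp. 126–127] [cite: HarishChandra1975HARRG1, §17 Lemma 17.5] -/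
theorem ArchCentralLimitFormulaRankTwo.of_limitExists_of_ball (h0 : 0 < (w.1.embedding (α 0)).re) (h1 : 0 < (w.1.embedding (α 1)).re) (h2 : (w.1.embedding (α 2)).re < 0)
    (hex :
      ∀ [LocallyCompactSpace (archLocal L 3 (Matrix.diagonal α) w)] [SecondCountableTopology (archLocal L 3 (Matrix.diagonal α) w)]
        [MeasurableSpace (archLocal L 3 (Matrix.diagonal α) w)] [BorelSpace (archLocal L 3 (Matrix.diagonal α) w)],
        (∀ i, α i ≠ 0) → (∀ i, (w.1.embedding (α i)).im = 0) →
        (∃ i j : Fin 3, (w.1.embedding (α i)).re * (w.1.embedding (α j)).re < 0) →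
        ∀ (ν : Measure (archLocal L 3 (Matrix.diagonal α) w)) [ν.IsHaarMeasure] [ν.IsMulRightInvariant],
          ∀ (Θ : Matrix (Fin 3) (Fin 3) ℂ → ℂ), ContDiff ℝ (⊤ : ℕ∞) Θ →
            HasCompactSupport (fun k : archLocal L 3 (Matrix.diagonal α) w => Θ ((k : GL (Fin 3) ℂ) : Matrix (Fin 3) (Fin 3) ℂ)) →
            ∀ ζ : Circle, ∃ V : ℂ,
              Tendsto (fun z : Fin 3 → Circle =>
                  (1 / 48 : ℂ) * ∑ ε : Fin 3 → Bool, ((((if ε 0 then (1 : ℝ) else -1) * (if ε 1 then (1 : ℝ) else -1) * (if ε 2 then (1 : ℝ) else -1) : ℝ)) : ℂ) *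
                    iteratedDeriv 3 (fun s : ℝ => ((((z 0 * Circle.exp (s * (![(if ε 0 then (1 : ℝ) else -1) + (if ε 1 then (1 : ℝ) else -1), -(if ε 0 then (1 : ℝ) else -1) + (if ε 2 then (1 : ℝ) else -1), -(if ε 1 then (1 : ℝ) else -1) - (if ε 2 then (1 : ℝ) else -1)] 0)) : Circle) : ℂ)) * (((z 2 * Circle.exp (s * (![(if ε 0 then (1 : ℝ) else -1) + (if ε 1 then (1 : ℝ) else -1), -(if ε 0 then (1 : ℝ) else -1) + (if ε 2 then (1 : ℝ) else -1), -(if ε 1 then (1 : ℝ) else -1) - (if ε 2 then (1 : ℝ) else -1)] 2)) : Circle) : ℂ))⁻¹) * ((1 - (((z 1 * Circle.exp (s * (![(if ε 0 then (1 : ℝ) else -1) + (if ε 1 then (1 : ℝ) else -1), -(if ε 0 then (1 : ℝ) else -1) + (if ε 2 then (1 : ℝ) else -1), -(if ε 1 then (1 : ℝ) else -1) - (if ε 2 then (1 : ℝ) else -1)] 1)) : Circle) : ℂ)) * (((z 0 * Circle.exp (s * (![(if ε 0 then (1 : ℝ) else -1) + (if ε 1 then (1 : ℝ) else -1), -(if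 ε 0 then (1 : ℝ) else -1) + (if ε 2 then (1 : ℝ) else -1), -(if ε 1 then (1 : ℝ) else -1) - (if ε 2 then (1 : ℝ) else -1)] 0)) : Circle) : ℂ))⁻¹) * (1 - (((z 2 * Circle.exp (s * (![(if ε 0 then (1 : ℝ) else -1) + (if ε 1 then (1 : ℝ) else -1), -(if ε 0 then (1 : ℝ) else -1) + (if ε 2 then (1 : ℝ) else -1), -(if ε 1 then (1 : ℝ) else -1) - (if ε 2 then (1 : ℝ) else -1)] 2)) : Circle) : ℂ)) * (((z 1 * Circle.exp (s * (![(if ε 0 then (1 : ℝ) else -1) + (if ε 1 then (1 : ℝ) else -1), -(if ε 0 then (1 : ℝ) else -1) + (if ε 2 then (1 : ℝ) else -1), -(if ε 1 then (1 : ℝ) else -1) - (if ε 2 then (1 : ℝ) else -1)] 1)) : Circle) : ℂ))⁻¹) * (1 - (((z 2 * Circle.exp (s * (![(if ε 0 then (1 : ℝ) else -1) + (if ε 1 then (1 : ℝ) else -1), -(if ε 0 then (1 : ℝ) else -1) + (if ε 2 then (1 : ℝ) else -1), -(if ε 1 then (1 : ℝ) else -1) - (if ε 2 then (1 : ℝ)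 else -1)] 2)) : Circle) : ℂ)) * (((z 0 * Circle.exp (s * (![(if ε 0 then (1 : ℝ) else -1) + (if ε 1 then (1 : ℝ) else -1), -(if ε 0 then (1 : ℝ) else -1) + (if ε 2 then (1 : ℝ) else -1), -(if ε 1 then (1 : ℝ) else -1) - (if ε 2 then (1 : ℝ) else -1)] 0)) : Circle) : ℂ))⁻¹)) * (∫ g, Θ (((g * ⟨circleDiagonal 3 (fun k => z k * Circle.exp (s * (![(if ε 0 then (1 : ℝ) else -1) + (if ε 1 then (1 : ℝ) else -1), -(if ε 0 then (1 : ℝ) else -1) + (if ε 2 then (1 : ℝ) else -1), -(if ε 1 then (1 : ℝ) else -1) - (if ε 2 then (1 : ℝ) else -1)] k))), circleDiagonal_mem_archLocal_diagonal L 3 α w _⟩ * g⁻¹ : archLocal L 3 (Matrix.diagonal α) w) : GL (Fin 3) ℂ) : Matrix (Fin 3) (Fin 3) ℂ) ∂ν)) 0)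
                (𝓝[{z : Fin 3 → Circle | Function.Injective z}] (fun _ => ζ))
                (𝓝 V))
    (hBall : ∀ (μ : Measure BallModel.U21) [μ.IsHaarMeasure],
      ∃ c : ℝ, 0 < c ∧ ∀ (Θ' : Matrix (Fin 3) (Fin 3) ℂ → ℂ), ContDiff ℝ (⊤ : ℕ∞) Θ' →
        HasCompactSupport (fun u : BallModel.U21 => Θ' (BallModel.mat u)) →
        (∀ κ : Matrix (Fin 3) (Fin 3) ℂ, κ * κᴴ = 1 → κ * BallModel.J = BallModel.J * κ → ∀ X, Θ' (κ * X * κᴴ) = Θ' X) →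
        ∀ ζ : Circle, ∃ (δ : ℝ) (ψ χ : ℝ → ℂ), 0 < δ ∧ δ ≤ 2 ∧ ContDiffOn ℝ 2 ψ (Icc 0 δ) ∧ ContDiffOn ℝ 2 χ (Icc 0 δ) ∧
          (∀ t ∈ Ioo 0 δ, ψ t = ((2 - 2 * Real.cos (3 * t) : ℝ) : ℂ) *
            ∫ u, Θ' (BallModel.mat (u * BallModel.mkU21 (Matrix.diagonal fun i => (((fun j : Fin 3 => ζ * Circle.exp ((t • (![1, 1, -2] : Fin 3 → ℝ)) j)) i : Circle) : ℂ)) (BallModel.diagonal_circle_preserves (fun j : Fin 3 => ζ * Circle.exp ((t • (![1, 1, -2] : Fin 3 → ℝ)) j))) * u⁻¹)) ∂μ) ∧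
          (∀ t ∈ Ioo 0 δ, χ t = ((2 - 2 * Real.cos (3 * t) : ℝ) : ℂ) ^ 2 * iteratedDeriv 2 (fun s : ℝ =>
            ∫ u, Θ' (BallModel.mat (u * BallModel.mkU21 (Matrix.diagonal fun i => (((fun j : Fin 3 => (fun i : Fin 3 => ζ * Circle.exp ((t • (![1, 1, -2] : Fin 3 → ℝ)) i)) j * Circle.exp (s * (![1, -1, 0] : Fin 3 → ℝ) j)) i : Circle) : ℂ)) (BallModel.diagonal_circle_preserves (fun j : Fin 3 => (fun i : Fin 3 => ζ * Circle.exp ((t • (![1, 1, -2] : Fin 3 → ℝ)) i)) j * Circle.exp (s * (![1, -1, 0] : Fin 3 → ℝ) j))) * u⁻¹)) ∂μ) 0) ∧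
          -(2 / 3) * Complex.I * iteratedDerivWithin 2 ψ (Icc 0 δ) 0 - (1 / 2) * Complex.I * ψ 0 + (1 / 12) * Complex.I * iteratedDerivWithin 2 χ (Icc 0 δ) 0 =
            -((c : ℂ) * Complex.I) * Θ' ((circleDiagonal 3 (fun _ => ζ) : GL (Fin 3) ℂ) : Matrix (Fin 3) (Fin 3) ℂ)) :
    ArchCentralLimitFormulaRankTwo L α w := by
  intro _ _ _ _ hα hreal hind ν _ _
  obtain ⟨c, hc, hΘ⟩ := centralLimit_eq_of_ball_of_tendsto L α w h0 h1 h2 hBall hα hreal ν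
  refine ⟨c, hc, fun Θ hΘd hΘc ζ => ?_⟩
  obtain ⟨V, hV⟩ := hex hα hreal hind ν Θ hΘd hΘc ζ
  have hVeq : V = -((c : ℂ) * Complex.I) * Θ ((circleDiagonal 3 (fun _ => ζ) : GL (Fin 3) ℂ) : Matrix (Fin 3) (Fin 3) ℂ) := hΘ Θ hΘd hΘc ζ V hV
  rw [← hVeq]
  exact hV

/-- **The (L_{U(2,1)}) letter at a `(+,+,−)` frame FROM (A6′) AND W6-core's `hcore`** (★ `stub_W6core` of «SdArch» ED. 5, text VERBATIM; ★ `ballWallValue_of_core` turns it into `hBall`).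
[cite: Rogawski1990, §8.4 pp. 126–127] [cite: HarishChandra1975HARRG1, §17 Lemma 17.5] -/
theorem ArchCentralLimitFormulaRankTwo.of_limitExists_of_core (h0 : 0 < (w.1.embedding (α 0)).re) (h1 : 0 < (w.1.embedding (α 1)).re) (h2 : (w.1.embedding (α 2)).re < 0)
    (hex :
      ∀ [LocallyCompactSpace (archLocal L 3 (Matrix.diagonal α) w)] [SecondCountableTopology (archLocal L 3 (Matrix.diagonal α) w)]
        [MeasurableSpace (archLocal L 3 (Matrix.diagonal α) w)] [BorelSpace (archLocal L 3 (Matrix.diagonal α) w)],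
        (∀ i, α i ≠ 0) → (∀ i, (w.1.embedding (α i)).im = 0) →
        (∃ i j : Fin 3, (w.1.embedding (α i)).re * (w.1.embedding (α j)).re < 0) →
        ∀ (ν : Measure (archLocal L 3 (Matrix.diagonal α) w)) [ν.IsHaarMeasure] [ν.IsMulRightInvariant],
          ∀ (Θ : Matrix (Fin 3) (Fin 3) ℂ → ℂ), ContDiff ℝ (⊤ : ℕ∞) Θ →
            HasCompactSupport (fun k : archLocal L 3 (Matrix.diagonal α) w => Θ ((k : GL (Fin 3) ℂ) : Matrix (Fin 3) (Fin 3) ℂ)) →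
            ∀ ζ : Circle, ∃ V : ℂ,
              Tendsto (fun z : Fin 3 → Circle =>
                  (1 / 48 : ℂ) * ∑ ε : Fin 3 → Bool, ((((if ε 0 then (1 : ℝ) else -1) * (if ε 1 then (1 : ℝ) else -1) * (if ε 2 then (1 : ℝ) else -1) : ℝ)) : ℂ) *
                    iteratedDeriv 3 (fun s : ℝ => ((((z 0 * Circle.exp (s * (![(if ε 0 then (1 : ℝ) else -1) + (if ε 1 then (1 : ℝ) else -1), -(if ε 0 then (1 : ℝ) else -1) + (if ε 2 then (1 : ℝ) else -1), -(if ε 1 then (1 : ℝ) else -1) - (if ε 2 then (1 : ℝ) else -1)] 0)) : Circle) : ℂ)) * (((z 2 * Circle.exp (s * (![(if ε 0 then (1 : ℝ) else -1) + (if ε 1 then (1 : ℝ) else -1), -(if ε 0 then (1 : ℝ) else -1) + (if ε 2 then (1 : ℝ) else -1), -(if ε 1 then (1 : ℝ) else -1) - (if ε 2 then (1 : ℝ) else -1)] 2)) : Circle) : ℂ))⁻¹) * ((1 - (((z 1 * Circle.exp (s * (![(if ε 0 then (1 : ℝ) else -1) + (if ε 1 then (1 : ℝ) else -1), -(if ε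 0 then (1 : ℝ) else -1) + (if ε 2 then (1 : ℝ) else -1), -(if ε 1 then (1 : ℝ) else -1) - (if ε 2 then (1 : ℝ) else -1)] 1)) : Circle) : ℂ)) * (((z 0 * Circle.exp (s * (![(if ε 0 then (1 : ℝ) else -1) + (if ε 1 then (1 : ℝ) else -1), -(if ε 0 then (1 : ℝ) else -1) + (if ε 2 then (1 : ℝ) else -1), -(if ε 1 then (1 : ℝ) else -1) - (if ε 2 then (1 : ℝ) else -1)] 0)) : Circle) : ℂ))⁻¹) * (1 - (((z 2 * Circle.exp (s * (![(if ε 0 then (1 : ℝ) else -1) + (if ε 1 then (1 : ℝ) else -1), -(if ε 0 then (1 : ℝ) else -1) + (if ε 2 then (1 : ℝ) else -1), -(if ε 1 then (1 : ℝ) else -1) - (if ε 2 then (1 : ℝ) else -1)] 2)) : Circle) : ℂ)) * (((z 1 * Circle.exp (s * (![(if ε 0 then (1 : ℝ) else -1) + (if ε 1 then (1 : ℝ) else -1), -(if ε 0 then (1 : ℝ) else -1) + (if ε 2 then (1 : ℝ) else -1), -(if ε 1 then (1 : ℝ) else -1) - (if ε 2 then (1 : ℝ) else -1)] 1)) : Circle)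 : ℂ))⁻¹) * (1 - (((z 2 * Circle.exp (s * (![(if ε 0 then (1 : ℝ) else -1) + (if ε 1 then (1 : ℝ) else -1), -(if ε 0 then (1 : ℝ) else -1) + (if ε 2 then (1 : ℝ) else -1), -(if ε 1 then (1 : ℝ) else -1) - (if ε 2 then (1 : ℝ) else -1)] 2)) : Circle) : ℂ)) * (((z 0 * Circle.exp (s * (![(if ε 0 then (1 : ℝ) else -1) + (if ε 1 then (1 : ℝ) else -1), -(if ε 0 then (1 : ℝ) else -1) + (if ε 2 then (1 : ℝ) else -1), -(if ε 1 then (1 : ℝ) else -1) - (if ε 2 then (1 : ℝ) else -1)] 0)) : Circle) : ℂ))⁻¹)) * (∫ g, Θ (((g * ⟨circleDiagonal 3 (fun k => z k * Circle.exp (s * (![(if ε 0 then (1 : ℝ) else -1) + (if ε 1 then (1 : ℝ) else -1), -(if ε 0 then (1 : ℝ) else -1) + (if ε 2 then (1 : ℝ) else -1), -(if ε 1 then (1 : ℝ) else -1) - (if ε 2 then (1 : ℝ) else -1)] k))), circleDiagonal_mem_archLocal_diagonal L 3 α w _⟩ * g⁻¹ : archLocal L 3 (Matrix.diagonal α) w)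 : GL (Fin 3) ℂ) : Matrix (Fin 3) (Fin 3) ℂ) ∂ν)) 0)
                (𝓝[{z : Fin 3 → Circle | Function.Injective z}] (fun _ => ζ))
                (𝓝 V))
    (hcore : ∀ (μ : Measure BallModel.U21) [μ.IsHaarMeasure],
      ∃ c : ℝ, 0 < c ∧ ∀ (Θ : Matrix (Fin 3) (Fin 3) ℂ → ℂ), ContDiff ℝ (⊤ : ℕ∞) Θ → HasCompactSupport Θ →
        (∀ κ : Matrix (Fin 3) (Fin 3) ℂ, κ * κᴴ = 1 → κ * BallModel.J = BallModel.J * κ → ∀ X, Θ (κ * X * κᴴ) = Θ X) →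
        ∀ ζ : Circle, ∃ (δ : ℝ) (ψ χ : ℝ → ℂ), 0 < δ ∧ δ ≤ 2 ∧ ContDiffOn ℝ 2 ψ (Icc 0 δ) ∧ ContDiffOn ℝ 2 χ (Icc 0 δ) ∧
          (∀ t ∈ Ioo 0 δ, (2 - 2 * Real.cos (3 * t)) • (∫ g, Θ (BallModel.mat (g * BallModel.mkU21 (Matrix.diagonal ![((ζ * Circle.exp t : Circle) : ℂ), ((ζ * Circle.exp t : Circle) : ℂ), ((ζ * Circle.exp (-2 * t) : Circle) : ℂ)]) (BallModel.diagonal_uuv_preserves (ζ * Circle.exp t) (ζ * Circle.exp (-2 * t))) * g⁻¹)) ∂μ) = ψ t) ∧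
          (∀ t ∈ Ioo 0 δ, ‖((ζ * Circle.exp (-2 * t) : Circle) : ℂ) - ((ζ * Circle.exp t : Circle) : ℂ)‖ ^ 4 •
            iteratedDeriv 2 (fun y : ℝ => ∫ u : BallModel.U21, Θ (BallModel.mat u * Matrix.diagonal (fun k : Fin 3 => (((![ζ * Circle.exp t, ζ * Circle.exp t, ζ * Circle.exp (-2 * t)] : Fin 3 → Circle) k * Circle.exp (y * ((if k = (0 : Fin 3) then (1 : ℝ) else 0) - (if k = (1 : Fin 3) then (1 : ℝ) else 0))) : Circle) : ℂ)) * BallModel.mat u⁻¹) ∂μ) 0 = χ t) ∧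
          -(2 / 3) * Complex.I * iteratedDerivWithin 2 ψ (Icc 0 δ) 0 - (1 / 2) * Complex.I * ψ 0 + (1 / 12) * Complex.I * iteratedDerivWithin 2 χ (Icc 0 δ) 0 =
            -((c : ℂ) * Complex.I) * Θ ((ζ : ℂ) • (1 : Matrix (Fin 3) (Fin 3) ℂ))) :
    ArchCentralLimitFormulaRankTwo L α w :=
  ArchCentralLimitFormulaRankTwo.of_limitExists_of_ball L α w h0 h1 h2 hex (ballWallValue_of_core hcore)

end Letter

section AllFrames

/-- **THE (L_{U(2,1)}) LETTER AT EVERY FRAME FROM (A6′) AND W6-core** — the closer-shaped statement: `(∀ L α w, ArchCentralLimitExists L α w)` (UNFOLDED; the continuity half of Rogawski p. 126 L13 =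
[H₂] L. 17.5, PRINTED) and `hcore` (= ★ `stub_W6core`, IN-HOUSE) give `∀ L α w, ArchCentralLimitFormulaRankTwo L α w` (★ `archCentralLimitFormulaRankTwo_of_ppm` reduces every frame to the CM
pattern `(+,+,−)`, where §6 applies).  USE: `stub_ArchCentralLimitU21 := archCentralLimitFormulaRankTwo_of_limitExists_of_core stub_A6' stub_W6core` — no corner extension (A6), no third-jet
jump (Z5). [cite: Rogawski1990, §8.4 pp. 126–127] [cite: HarishChandra1975HARRG1, §17 Lemma 17.5] -/
theorem archCentralLimitFormulaRankTwo_of_limitExists_of_core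
    (hex : ∀ (L : Type) [Field L] (α : Fin 3 → L) (w : {w : InfinitePlace L // IsComplex w}),
        ∀ [LocallyCompactSpace (archLocal L 3 (Matrix.diagonal α) w)] [SecondCountableTopology (archLocal L 3 (Matrix.diagonal α) w)]
          [MeasurableSpace (archLocal L 3 (Matrix.diagonal α) w)] [BorelSpace (archLocal L 3 (Matrix.diagonal α) w)],
          (∀ i, α i ≠ 0) → (∀ i, (w.1.embedding (α i)).im = 0) →
          (∃ i j : Fin 3, (w.1.embedding (α i)).re * (w.1.embedding (α j)).re < 0) →
          ∀ (ν : Measure (archLocal L 3 (Matrix.diagonal α) w)) [ν.IsHaarMeasure] [ν.IsMulRightInvariant],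
            ∀ (Θ : Matrix (Fin 3) (Fin 3) ℂ → ℂ), ContDiff ℝ (⊤ : ℕ∞) Θ →
              HasCompactSupport (fun k : archLocal L 3 (Matrix.diagonal α) w => Θ ((k : GL (Fin 3) ℂ) : Matrix (Fin 3) (Fin 3) ℂ)) →
              ∀ ζ : Circle, ∃ V : ℂ,
                Tendsto (fun z : Fin 3 → Circle =>
                    (1 / 48 : ℂ) * ∑ ε : Fin 3 → Bool, ((((if ε 0 then (1 : ℝ) else -1) * (if ε 1 then (1 : ℝ) else -1) * (if ε 2 then (1 : ℝ) else -1) : ℝ)) : ℂ) *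
                      iteratedDeriv 3 (fun s : ℝ => ((((z 0 * Circle.exp (s * (![(if ε 0 then (1 : ℝ) else -1) + (if ε 1 then (1 : ℝ) else -1), -(if ε 0 then (1 : ℝ) else -1) + (if ε 2 then (1 : ℝ) else -1), -(if ε 1 then (1 : ℝ) else -1) - (if ε 2 then (1 : ℝ) else -1)] 0)) : Circle) : ℂ)) * (((z 2 * Circle.exp (s * (![(if ε 0 then (1 : ℝ) else -1) + (if ε 1 then (1 : ℝ) else -1), -(if ε 0 then (1 : ℝ) else -1) + (if ε 2 then (1 : ℝ) else -1), -(if ε 1 then (1 : ℝ) else -1) - (if ε 2 then (1 : ℝ) else -1)] 2)) : Circle) : ℂ))⁻¹) * ((1 - (((z 1 * Circle.exp (s * (![(if ε 0 then (1 : ℝ) else -1) + (if ε 1 then (1 : ℝ) else -1), -(if ε 0 then (1 : ℝ) else -1) + (if ε 2 then (1 : ℝ) else -1), -(if ε 1 then (1 : ℝ) else -1) - (if ε 2 then (1 : ℝ) else -1)] 1)) : Circle) : ℂ)) * (((z 0 * Circle.exp (s * (![(if ε 0 then (1 : ℝ) else -1) + (if ε 1 then (1 : ℝ) else -1), -(if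 ε 0 then (1 : ℝ) else -1) + (if ε 2 then (1 : ℝ) else -1), -(if ε 1 then (1 : ℝ) else -1) - (if ε 2 then (1 : ℝ) else -1)] 0)) : Circle) : ℂ))⁻¹) * (1 - (((z 2 * Circle.exp (s * (![(if ε 0 then (1 : ℝ) else -1) + (if ε 1 then (1 : ℝ) else -1), -(if ε 0 then (1 : ℝ) else -1) + (if ε 2 then (1 : ℝ) else -1), -(if ε 1 then (1 : ℝ) else -1) - (if ε 2 then (1 : ℝ) else -1)] 2)) : Circle) : ℂ)) * (((z 1 * Circle.exp (s * (![(if ε 0 then (1 : ℝ) else -1) + (if ε 1 then (1 : ℝ) else -1), -(if ε 0 then (1 : ℝ) else -1) + (if ε 2 then (1 : ℝ) else -1), -(if ε 1 then (1 : ℝ) else -1) - (if ε 2 then (1 : ℝ) else -1)] 1)) : Circle) : ℂ))⁻¹) * (1 - (((z 2 * Circle.exp (s * (![(if ε 0 then (1 : ℝ) else -1) + (if ε 1 then (1 : ℝ) else -1), -(if ε 0 then (1 : ℝ) else -1) + (if ε 2 then (1 : ℝ) else -1), -(if ε 1 then (1 : ℝ) else -1) - (if ε 2 then (1 : ℝ)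 else -1)] 2)) : Circle) : ℂ)) * (((z 0 * Circle.exp (s * (![(if ε 0 then (1 : ℝ) else -1) + (if ε 1 then (1 : ℝ) else -1), -(if ε 0 then (1 : ℝ) else -1) + (if ε 2 then (1 : ℝ) else -1), -(if ε 1 then (1 : ℝ) else -1) - (if ε 2 then (1 : ℝ) else -1)] 0)) : Circle) : ℂ))⁻¹)) * (∫ g, Θ (((g * ⟨circleDiagonal 3 (fun k => z k * Circle.exp (s * (![(if ε 0 then (1 : ℝ) else -1) + (if ε 1 then (1 : ℝ) else -1), -(if ε 0 then (1 : ℝ) else -1) + (if ε 2 then (1 : ℝ) else -1), -(if ε 1 then (1 : ℝ) else -1) - (if ε 2 then (1 : ℝ) else -1)] k))), circleDiagonal_mem_archLocal_diagonal L 3 α w _⟩ * g⁻¹ : archLocal L 3 (Matrix.diagonal α) w) : GL (Fin 3) ℂ) : Matrix (Fin 3) (Fin 3) ℂ) ∂ν)) 0)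
                  (𝓝[{z : Fin 3 → Circle | Function.Injective z}] (fun _ => ζ))
                  (𝓝 V))
    (hcore : ∀ (μ : Measure BallModel.U21) [μ.IsHaarMeasure],
      ∃ c : ℝ, 0 < c ∧ ∀ (Θ : Matrix (Fin 3) (Fin 3) ℂ → ℂ), ContDiff ℝ (⊤ : ℕ∞) Θ → HasCompactSupport Θ →
        (∀ κ : Matrix (Fin 3) (Fin 3) ℂ, κ * κᴴ = 1 → κ * BallModel.J = BallModel.J * κ → ∀ X, Θ (κ * X * κᴴ) = Θ X) →
        ∀ ζ : Circle, ∃ (δ : ℝ) (ψ χ : ℝ → ℂ), 0 < δ ∧ δ ≤ 2 ∧ ContDiffOn ℝ 2 ψ (Icc 0 δ) ∧ ContDiffOn ℝ 2 χ (Icc 0 δ) ∧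
          (∀ t ∈ Ioo 0 δ, (2 - 2 * Real.cos (3 * t)) • (∫ g, Θ (BallModel.mat (g * BallModel.mkU21 (Matrix.diagonal ![((ζ * Circle.exp t : Circle) : ℂ), ((ζ * Circle.exp t : Circle) : ℂ), ((ζ * Circle.exp (-2 * t) : Circle) : ℂ)]) (BallModel.diagonal_uuv_preserves (ζ * Circle.exp t) (ζ * Circle.exp (-2 * t))) * g⁻¹)) ∂μ) = ψ t) ∧
          (∀ t ∈ Ioo 0 δ, ‖((ζ * Circle.exp (-2 * t) : Circle) : ℂ) - ((ζ * Circle.exp t : Circle) : ℂ)‖ ^ 4 •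
            iteratedDeriv 2 (fun y : ℝ => ∫ u : BallModel.U21, Θ (BallModel.mat u * Matrix.diagonal (fun k : Fin 3 => (((![ζ * Circle.exp t, ζ * Circle.exp t, ζ * Circle.exp (-2 * t)] : Fin 3 → Circle) k * Circle.exp (y * ((if k = (0 : Fin 3) then (1 : ℝ) else 0) - (if k = (1 : Fin 3) then (1 : ℝ) else 0))) : Circle) : ℂ)) * BallModel.mat u⁻¹) ∂μ) 0 = χ t) ∧
          -(2 / 3) * Complex.I * iteratedDerivWithin 2 ψ (Icc 0 δ) 0 - (1 / 2) * Complex.I * ψ 0 + (1 / 12) * Complex.I * iteratedDerivWithin 2 χ (Icc 0 δ) 0 =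
            -((c : ℂ) * Complex.I) * Θ ((ζ : ℂ) • (1 : Matrix (Fin 3) (Fin 3) ℂ))) :
    ∀ (L : Type) [Field L] (α : Fin 3 → L) (w : {w : InfinitePlace L // IsComplex w}), ArchCentralLimitFormulaRankTwo L α w :=
  archCentralLimitFormulaRankTwo_of_ppm fun L₀ _ _ _ α₀ w₀ h0 h1 h2 =>
    ArchCentralLimitFormulaRankTwo.of_limitExists_of_core L₀ α₀ w₀ h0 h1 h2 (hex L₀ α₀ w₀) hcore

end AllFrames

end Literature.NumberTheory.Rogawski1990

end
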